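import Mathlib.LinearAlgebra.Dimension.Finrank
import Mathlib.LinearAlgebra.FiniteDimensional.Lemmas
import Mathlib.Data.ZMod.Basic
import Mathlib.FieldTheory.Finite.Basic
import HarnessLib

/-!
# The junta set of a system of linear forms (regularisation for rung R11', subspace form)

Planner qa-qnc0-p2 g15, ROUND-15 (p2) §3.11 step (1) (Chattopadhyay–Wigderson 2009 §3.5 / Chattopadhyay–Lovett 2011, greedy
form; qn-lit g17 22:49Z): for a subspace `L` of linear forms on `{0,1}ⁿ` over a field and a threshold `w`, there is a coordinate
set `J` with `|J| ≤ dim L · w` such that every form of `L` with FEWER than `w` non-zero coefficients outside `J` has NO non-zero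
coefficient outside `J` — i.e. modulo the `J`-junta forms the system is `w`-regular.  Proof: while some `β ∈ L` is not supported
in `J` but has `< w` non-zeros outside, add them to `J`; the subspace of `J`-supported forms of `L` grows strictly, so this happens
at most `dim L` times.  No change of basis is needed in this formulation (the consumer conditions on the bits of `J` and expands
the regular part, cf. `LinFormsRegular.card_win_le_of_regular`).
WHAT THIS IS NOT: pure linear algebra; the R11' assembly (junta-conditioned twisted bound) is not here; separation NOT moved.
-/

namespace Summit.QuantumAdvantage.AdviceFreeQNC0

open Finset Module

namespace LinForms

variable {F : Type*} [Field F] {n : ℕ}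

/-- The forms supported inside `J`. -/
def suppIn (J : Finset (Fin n)) : Submodule F (Fin n → F) where
  carrier := {β | ∀ i, i ∉ J → β i = 0}
  add_mem' := by intro a b ha hb i hi; simp [ha i hi, hb i hi]
  zero_mem' := by intro i _; rfl
  smul_mem' := by intro c a ha i hi; simp [ha i hi]

/-- Membership in `suppIn`. -/
theorem mem_suppIn {J : Finset (Fin n)} {β : Fin n → F} : β ∈ suppIn (F := F) J ↔ ∀ i, i ∉ J → β i = 0 := Iff.rfl

/-- `suppIn` is monotone. -/
theorem suppIn_mono {J J' : Finset (Fin n)} (h : J ⊆ J') : suppIn (F := F) J ≤ suppIn J' :=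
  fun _ hβ i hi => hβ i (fun hJ => hi (h hJ))

variable [DecidableEq F]

/-- The non-zero coefficients of `β` outside `J`. -/
def outSupp (J : Finset (Fin n)) (β : Fin n → F) : Finset (Fin n) := univ.filter fun i => i ∉ J ∧ β i ≠ 0

/-- `J` is `w`-regular for `L`: a form of `L` with fewer than `w` non-zeros outside `J` is supported in `J`. -/
def Regular (L : Submodule F (Fin n → F)) (w : ℕ) (J : Finset (Fin n)) : Prop :=
  ∀ β ∈ L, (outSupp J β).card < w → β ∈ suppIn (F := F) J

/-- The greedy step, iterated: from any `J`, at most `d` enlargements by `< w` coordinates reach a regular set, where `d`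
bounds the codimension of the `J`-supported part of `L`. -/
theorem exists_regular_aux (L : Submodule F (Fin n → F)) (w : ℕ) :
    ∀ d : ℕ, ∀ J : Finset (Fin n), finrank F L ≤ finrank F ↥(L ⊓ suppIn J) + d →
      ∃ J' : Finset (Fin n), J ⊆ J' ∧ J'.card ≤ J.card + d * w ∧ Regular L w J' := by
  intro d
  induction d with
  | zero =>
    intro J hd
    refine ⟨J, subset_rfl, by simp, fun β hβ _ => ?_⟩
    -- `L ⊓ suppIn J = L`
    have hle : L ⊓ suppIn (F := F) J ≤ L := inf_le_left
    have heq : L ⊓ suppIn (F := F) J = L :=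
      Submodule.eq_of_le_of_finrank_le hle (by simpa using hd)
    have : β ∈ L ⊓ suppIn (F := F) J := by rw [heq]; exact hβ
    exact this.2
  | succ d ih =>
    intro J hd
    by_cases hreg : Regular L w J
    · exact ⟨J, subset_rfl, by simp, hreg⟩
    · unfold Regular at hreg
      push Not at hreg
      obtain ⟨β, hβL, hβw, hβJ⟩ := hreg
      set J₁ := J ∪ outSupp J β with hJ₁
      have hsub : J ⊆ J₁ := subset_union_left
      have hcard : J₁.card ≤ J.card + w := by
        calc J₁.card ≤ J.card + (outSupp J β).card := Finset.card_union_le _ _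
          _ ≤ J.card + w := by omega
      -- `β` is supported in `J₁` but not in `J`
      have hβ1 : β ∈ suppIn (F := F) J₁ := by
        intro i hi
        by_contra hne
        apply hi
        rw [hJ₁, mem_union]
        right
        unfold outSupp
        rw [mem_filter]
        exact ⟨mem_univ _, fun hJ => hi (by rw [hJ₁, mem_union]; exact Or.inl hJ), hne⟩
      have hlt : L ⊓ suppIn (F := F) J < L ⊓ suppIn J₁ := by
        refine lt_of_le_of_ne (inf_le_inf_left _ (suppIn_mono hsub)) fun heq => hβJ ?_
        have : β ∈ L ⊓ suppIn (F := F) J₁ := ⟨hβL, hβ1⟩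
        rw [← heq] at this
        exact this.2
      have hrank : finrank F ↥(L ⊓ suppIn (F := F) J) < finrank F ↥(L ⊓ suppIn J₁) :=
        Submodule.finrank_lt_finrank_of_lt hlt
      obtain ⟨J', hJ', hcard', hreg'⟩ := ih J₁ (by omega)
      refine ⟨J', hsub.trans hJ', ?_, hreg'⟩
      calc J'.card ≤ J₁.card + d * w := hcard'
        _ ≤ J.card + w + d * w := by omega
        _ = J.card + (d + 1) * w := by ring

/-- **The junta set**: there is `J` with `|J| ≤ dim L · w` which is `w`-regular for `L`. -/
theorem exists_regular (L : Submodule F (Fin n → F)) (w : ℕ) :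
    ∃ J : Finset (Fin n), J.card ≤ finrank F L * w ∧ Regular L w J := by
  obtain ⟨J, _, hcard, hreg⟩ := exists_regular_aux L w (finrank F L) ∅ (by omega)
  exact ⟨J, by simpa using hcard, hreg⟩

/-- The span of `K` forms has a `w`-regular junta set of size `≤ K·w`. -/
theorem exists_regular_span {K : ℕ} (lam : Fin K → Fin n → F) (w : ℕ) :
    ∃ J : Finset (Fin n), J.card ≤ K * w ∧ Regular (Submodule.span F (Set.range lam)) w J := by
  obtain ⟨J, hcard, hreg⟩ := exists_regular (Submodule.span F (Set.range lam)) w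
  refine ⟨J, hcard.trans (Nat.mul_le_mul_right w ?_), hreg⟩
  calc finrank F ↥(Submodule.span F (Set.range lam)) ≤ Fintype.card (Fin K) := finrank_range_le_card lam
    _ = K := Fintype.card_fin K

end LinForms

end Summit.QuantumAdvantage.AdviceFreeQNC0
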